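import Mathlib
import HarnessLib.Audit

/-!
# Crux E `PowerGaugeEulerLiouville` (stmt-NavierStokesRegularity-19832): LINEAR ALGEBRA OF THE DSS PERIOD MAP AT A VORTICAL NODE —
# an operator on `ℝ³` with an expanding eigenvector and a small determinant has a dominated contracting splitting of some power
# (width seat ns-cas-k2 g3, lane «DSS thin vortical nodes», tool A′)

Route `EulerZoomLiouville` (NavierStokesRegularity), crux E.  At a VORTICAL permanent node of a discretely self-similar member (factor
`l > 1`, window `ρ > 0`) the derivative `M = DF(x*)` of the rescaled period map has the vorticity `ω*` as an eigenvector with eigenvalue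
`λ₀ = l·T > 1` (Cauchy's formula + the DSS law of the vorticity) and `det M = l³ < λ₀` (incompressibility).  This file is the pure
linear algebra turning those two facts into the hypothesis of the dominated cone lemma (`…DSSNodeIterateSplitting`):

* `det_eq_neg_charpoly_coeff_zero`, `exists_quadraticCofactor_det` — Cayley–Hamilton in coordinates for an operator `M` on `ℝ³` with a known
  eigenvector `Mω = λ₀ω`: `χ_M = (X − λ₀)(X² + uX + w)` as the operator identity `(M − λ₀)(M² + uM + w) = 0`, an eigenvector for every real
  root of the cofactor, and **`w·λ₀ = det M`**;
* `isCompl_ker_quadratic_ker_linear` — Bezout by hand: if `(M − λ)∘G = 0` for `G = M² + βM + γ₀` with `λ² + βλ + γ₀ ≠ 0`, then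
  `ker G ⊕ ker(M − λ) = ℝ³`, both `M`-invariant;
* rates of `M^k` on such kernels — exact on eigenlines, `N(Mx) = w·N(x)` for the ADAPTED QUADRATIC FORM `N(x) = ‖x‖² + δ⁻²‖(M + u/2)x‖²` on
  `ker(M² + uM + w)` when the cofactor has complex roots (`δ² = w − u²/4 > 0`), nilpotent bookkeeping `M^k = r^k + k r^{k−1}(M − r)` on
  `ker (M − r)²`, and Lagrange idempotents on `ker (M − r_b)(M − λ₀)`;
* **`exists_dominatedSplitting_pow`** — `Mω = λ₀ω` (`ω ≠ 0`), `1 < λ₀`, `0 < det M < λ₀` ⇒ there are `M`-invariant complementary subspaces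
  `Es ≠ ⊥`, `Ec ≠ ⊤` and `k ≥ 1`, `a < 1`, `a < b` with `‖M^k x‖ ≤ a‖x‖` on `Es` and `b‖x‖ ≤ ‖M^k x‖` on `Ec` (four spectral cases of the
  cofactor: complex pair / distinct real roots with `r_b ≠ λ₀` / `r_b = λ₀` / double root — the last two defective-friendly).

WHAT THIS IS NOT: not NS regularity, not the crux E — finite-dimensional linear algebra for hypothetical DSS blow-up members; 19832 is OPEN.
[folklore; Cayley–Hamilton; Robinson1999 Ch. V §5.10.1 (dominated splittings)]
-/

noncomputable section

set_option linter.dupNamespace false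

open Set Filter Topology Function
open scoped RealInnerProductSpace

namespace Summit.NavierStokesRegularity.NavierStokesRegularity.Theorems.PowerGaugeEulerLiouville.DSSNodes

/-! ### Cayley–Hamilton in coordinates, with the determinant -/

/-- `det f = −(constant coefficient of χ_f)` for an endomorphism of `ℝ³`. [folklore] -/
theorem det_eq_neg_charpoly_coeff_zero
    (f : EuclideanSpace ℝ (Fin 3) →ₗ[ℝ] EuclideanSpace ℝ (Fin 3)) :
    LinearMap.det f = -f.charpoly.coeff 0 := by
  set B := Module.finBasisOfFinrankEq ℝ (EuclideanSpace ℝ (Fin 3))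
    (finrank_euclideanSpace_fin : Module.finrank ℝ (EuclideanSpace ℝ (Fin 3)) = 3)
  rw [← LinearMap.det_toMatrix B, Matrix.det_eq_sign_charpoly_coeff, Fintype.card_fin, f.charpoly_toMatrix B]
  norm_num

/-- **Cayley–Hamilton and the linear factor, with the determinant.**  `M` an operator on `ℝ³` with `Mω = λ₀ω`, `ω ≠ 0`.  Writing
`χ_M = X³ + p₂X² + p₁X + p₀`, put `u = p₂ + λ₀`, `w = p₁ + λ₀u`; then `χ_M = (X − λ₀)(X² + uX + w)`, whence (i) the operator identity
`(M − λ₀)(M² + uM + w) = 0`, (ii) every real root `r` of `X² + uX + w` is an eigenvalue of `M`, (iii) `w·λ₀ = det M` (`det M = −p₀`).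
[folklore] -/
theorem exists_quadraticCofactor_det (M : EuclideanSpace ℝ (Fin 3) →L[ℝ] EuclideanSpace ℝ (Fin 3))
    {om : EuclideanSpace ℝ (Fin 3)} (hom : om ≠ 0) {lam₀ : ℝ} (hMom : M om = lam₀ • om) :
    ∃ u w : ℝ,
      (∀ x, M (M (M x) + u • M x + w • x) = lam₀ • (M (M x) + u • M x + w • x)) ∧
      (∀ r : ℝ, r ^ 2 + u * r + w = 0 → ∃ v : EuclideanSpace ℝ (Fin 3), v ≠ 0 ∧ M v = r • v) ∧
      w * lam₀ = M.det := by
  -- adapted from `Kelvin.exists_quadraticCofactor` (…SelfSimilarVorticalNodeThin), adding the determinant conjunct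
  set f : EuclideanSpace ℝ (Fin 3) →ₗ[ℝ] EuclideanSpace ℝ (Fin 3) :=
    (M : EuclideanSpace ℝ (Fin 3) →ₗ[ℝ] EuclideanSpace ℝ (Fin 3)) with hf
  set p : Polynomial ℝ := f.charpoly with hp
  have hp3 : p.natDegree = 3 := by rw [hp, LinearMap.charpoly_natDegree, finrank_euclideanSpace_fin]
  have hmonic : p.Monic := LinearMap.charpoly_monic f
  have hc3 : p.coeff 3 = 1 := by
    have h := hmonic.coeff_natDegree; rwa [hp3] at h
  have hCH : ∀ x, M (M (M x)) + p.coeff 2 • M (M x) + p.coeff 1 • M x + p.coeff 0 • x = 0 := by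
    intro x
    have h := LinearMap.aeval_self_charpoly f
    rw [Polynomial.aeval_eq_sum_range, ← hp, hp3] at h
    have hx := LinearMap.congr_fun h x
    simp only [Finset.sum_range_succ, Finset.sum_range_zero, zero_add, LinearMap.zero_apply, LinearMap.add_apply,
      LinearMap.smul_apply, hc3, one_smul, pow_zero, pow_succ] at hx
    rw [← hx]
    simp only [hf]
    module
  have hroot : lam₀ ^ 3 + p.coeff 2 * lam₀ ^ 2 + p.coeff 1 * lam₀ + p.coeff 0 = 0 := by
    have hev : Module.End.HasEigenvalue f lam₀ :=
      Module.End.hasEigenvalue_of_hasEigenvector ⟨Module.End.mem_eigenspace_iff.2 (by exact hMom), hom⟩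
    have h := (Module.End.hasEigenvalue_iff_isRoot_charpoly f lam₀).1 hev
    rw [Polynomial.IsRoot.def, Polynomial.eval_eq_sum_range, ← hp, hp3] at h
    simp only [Finset.sum_range_succ, Finset.sum_range_zero, zero_add, hc3, one_mul, pow_zero, mul_one] at h
    linarith
  have hdet : M.det = -p.coeff 0 := det_eq_neg_charpoly_coeff_zero f
  refine ⟨p.coeff 2 + lam₀, p.coeff 1 + lam₀ * (p.coeff 2 + lam₀), fun x => ?_, fun r hr => ?_, ?_⟩
  · have hp0 : p.coeff 0 = -(lam₀ ^ 3 + p.coeff 2 * lam₀ ^ 2 + p.coeff 1 * lam₀) := by linarith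
    have h := hCH x
    rw [hp0] at h
    rw [← sub_eq_zero]
    rw [← h]
    simp only [map_add, map_smul]
    module
  · have hr3 : p.IsRoot r := by
      rw [Polynomial.IsRoot.def, Polynomial.eval_eq_sum_range, hp3]
      simp only [Finset.sum_range_succ, Finset.sum_range_zero, zero_add, hc3, one_mul, pow_zero, mul_one]
      have hp0 : p.coeff 0 = -(lam₀ ^ 3 + p.coeff 2 * lam₀ ^ 2 + p.coeff 1 * lam₀) := by linarith
      rw [hp0]
      have : (r - lam₀) * (r ^ 2 + (p.coeff 2 + lam₀) * r + (p.coeff 1 + lam₀ * (p.coeff 2 + lam₀))) = 0 := by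
        rw [hr, mul_zero]
      nlinarith [this]
    have hev : Module.End.HasEigenvalue f r := (Module.End.hasEigenvalue_iff_isRoot_charpoly f r).2 hr3
    obtain ⟨v, hv⟩ := hev.exists_hasEigenvector
    exact ⟨v, hv.2, Module.End.mem_eigenspace_iff.1 hv.1⟩
  · rw [hdet]; linear_combination hroot

/-! ### Bezout by hand: `ker G ⊕ ker (M − λ)` for a quadratic `G` in `M` annihilated by `M − λ` -/

/-- The quadratic operator `G = M² + βM + γ₀` as a continuous linear map. -/
theorem quadOp_apply (M : EuclideanSpace ℝ (Fin 3) →L[ℝ] EuclideanSpace ℝ (Fin 3)) (β γ₀ : ℝ)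
    (x : EuclideanSpace ℝ (Fin 3)) :
    (M.comp M + β • M + γ₀ • ContinuousLinearMap.id ℝ (EuclideanSpace ℝ (Fin 3))) x = M (M x) + β • M x + γ₀ • x := by
  simp

/-- `G = M² + βM + γ₀` commutes with `M`. [folklore] -/
theorem quadOp_comm (M : EuclideanSpace ℝ (Fin 3) →L[ℝ] EuclideanSpace ℝ (Fin 3)) (β γ₀ : ℝ)
    (x : EuclideanSpace ℝ (Fin 3)) :
    M (M (M x) + β • M x + γ₀ • x) = M (M (M x)) + β • M (M x) + γ₀ • M x := by
  simp only [map_add, map_smul]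

/-- **Bezout by hand.**  `G = M² + βM + γ₀` with `(M − λ)(Gx) = 0` for all `x` and `c := λ² + βλ + γ₀ ≠ 0`.  Then `ker G` and
`ker(M − λ)` are complementary: `x = c⁻¹Gx − c⁻¹(M − λ)(M + λ + β)x` (polynomial identity `G − (X − λ)(X + λ + β) = c`), and on the
intersection `Gx = c·x`. [folklore] -/
theorem isCompl_ker_quadratic_ker_linear (M : EuclideanSpace ℝ (Fin 3) →L[ℝ] EuclideanSpace ℝ (Fin 3)) (β γ₀ lam : ℝ)
    (hzero : ∀ x, M (M (M x) + β • M x + γ₀ • x) - lam • (M (M x) + β • M x + γ₀ • x) = 0)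
    (hc : lam ^ 2 + β * lam + γ₀ ≠ 0) :
    IsCompl
      (LinearMap.ker ((M.comp M + β • M + γ₀ • ContinuousLinearMap.id ℝ (EuclideanSpace ℝ (Fin 3)) :
        EuclideanSpace ℝ (Fin 3) →L[ℝ] EuclideanSpace ℝ (Fin 3)) : EuclideanSpace ℝ (Fin 3) →ₗ[ℝ] EuclideanSpace ℝ (Fin 3)))
      (LinearMap.ker ((M - lam • ContinuousLinearMap.id ℝ (EuclideanSpace ℝ (Fin 3)) :
        EuclideanSpace ℝ (Fin 3) →L[ℝ] EuclideanSpace ℝ (Fin 3)) : EuclideanSpace ℝ (Fin 3) →ₗ[ℝ] EuclideanSpace ℝ (Fin 3))) := by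
  set c : ℝ := lam ^ 2 + β * lam + γ₀ with hcdef
  rw [isCompl_iff]
  constructor
  · rw [Submodule.disjoint_def]
    intro x hxG hxL
    rw [LinearMap.mem_ker, ContinuousLinearMap.coe_coe, quadOp_apply] at hxG
    rw [LinearMap.mem_ker, ContinuousLinearMap.coe_coe] at hxL
    have hMx : M x = lam • x := by
      have : M x - lam • x = 0 := by simpa using hxL
      exact sub_eq_zero.1 this
    have hcx : c • x = 0 := by
      rw [← hxG, hMx, map_smul, hMx, hcdef]
      module
    exact (smul_eq_zero.1 hcx).resolve_left hc
  · rw [codisjoint_iff_le_sup]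
    intro x _
    rw [Submodule.mem_sup]
    refine ⟨-(c⁻¹ • (M (M x + (lam + β) • x) - lam • (M x + (lam + β) • x))), ?_, c⁻¹ • (M (M x) + β • M x + γ₀ • x), ?_, ?_⟩
    · rw [LinearMap.mem_ker, ContinuousLinearMap.coe_coe, quadOp_apply]
      -- `G((M − λ)y) = (M − λ)(Gy) = 0` with `y = (M + λ + β)x`
      set y := M x + (lam + β) • x with hy
      have h1 := hzero y
      have e : M (M (-(c⁻¹ • (M y - lam • y)))) + β • M (-(c⁻¹ • (M y - lam • y))) + γ₀ • -(c⁻¹ • (M y - lam • y)) =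
          -(c⁻¹ • (M (M (M y) + β • M y + γ₀ • y) - lam • (M (M y) + β • M y + γ₀ • y))) := by
        simp only [map_add, map_smul, map_sub, map_neg]
        module
      rw [e, h1, smul_zero, neg_zero]
    · rw [LinearMap.mem_ker, ContinuousLinearMap.coe_coe]
      simp only [sub_apply, smul_apply, ContinuousLinearMap.id_apply, map_smul]
      rw [hzero x, smul_zero]
    · -- the polynomial identity `−(X − λ)(X + λ + β) + G = c`
      have e : -(c⁻¹ • (M (M x + (lam + β) • x) - lam • (M x + (lam + β) • x))) + c⁻¹ • (M (M x) + β • M x + γ₀ • x) =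
          (c⁻¹ * c) • x := by
        simp only [map_add, map_smul, hcdef]
        module
      rw [e, inv_mul_cancel₀ hc, one_smul]

/-- `ker G` is `M`-invariant (`G = M² + βM + γ₀`). [folklore] -/
theorem mem_ker_quadratic_of_mem (M : EuclideanSpace ℝ (Fin 3) →L[ℝ] EuclideanSpace ℝ (Fin 3)) (β γ₀ : ℝ)
    {x : EuclideanSpace ℝ (Fin 3)}
    (hx : x ∈ LinearMap.ker ((M.comp M + β • M + γ₀ • ContinuousLinearMap.id ℝ (EuclideanSpace ℝ (Fin 3)) :
        EuclideanSpace ℝ (Fin 3) →L[ℝ] EuclideanSpace ℝ (Fin 3)) : EuclideanSpace ℝ (Fin 3) →ₗ[ℝ] EuclideanSpace ℝ (Fin 3))) :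
    M x ∈ LinearMap.ker ((M.comp M + β • M + γ₀ • ContinuousLinearMap.id ℝ (EuclideanSpace ℝ (Fin 3)) :
        EuclideanSpace ℝ (Fin 3) →L[ℝ] EuclideanSpace ℝ (Fin 3)) : EuclideanSpace ℝ (Fin 3) →ₗ[ℝ] EuclideanSpace ℝ (Fin 3)) := by
  rw [LinearMap.mem_ker, ContinuousLinearMap.coe_coe, quadOp_apply] at hx ⊢
  rw [← quadOp_comm, hx, map_zero]

/-- `ker (M − λ)` is `M`-invariant. [folklore] -/
theorem mem_ker_linear_of_mem (M : EuclideanSpace ℝ (Fin 3) →L[ℝ] EuclideanSpace ℝ (Fin 3)) (lam : ℝ)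
    {x : EuclideanSpace ℝ (Fin 3)}
    (hx : x ∈ LinearMap.ker ((M - lam • ContinuousLinearMap.id ℝ (EuclideanSpace ℝ (Fin 3)) :
        EuclideanSpace ℝ (Fin 3) →L[ℝ] EuclideanSpace ℝ (Fin 3)) : EuclideanSpace ℝ (Fin 3) →ₗ[ℝ] EuclideanSpace ℝ (Fin 3))) :
    M x ∈ LinearMap.ker ((M - lam • ContinuousLinearMap.id ℝ (EuclideanSpace ℝ (Fin 3)) :
        EuclideanSpace ℝ (Fin 3) →L[ℝ] EuclideanSpace ℝ (Fin 3)) : EuclideanSpace ℝ (Fin 3) →ₗ[ℝ] EuclideanSpace ℝ (Fin 3)) := by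
  rw [LinearMap.mem_ker, ContinuousLinearMap.coe_coe] at hx ⊢
  simp only [sub_apply, smul_apply, ContinuousLinearMap.id_apply] at hx ⊢
  have hMx : M x = lam • x := sub_eq_zero.1 hx
  rw [hMx, map_smul, hMx, sub_self]

/-- Membership in `ker (M − λ)` means `Mx = λx`. [folklore] -/
theorem mem_ker_linear_iff (M : EuclideanSpace ℝ (Fin 3) →L[ℝ] EuclideanSpace ℝ (Fin 3)) (lam : ℝ)
    (x : EuclideanSpace ℝ (Fin 3)) :
    x ∈ LinearMap.ker ((M - lam • ContinuousLinearMap.id ℝ (EuclideanSpace ℝ (Fin 3)) :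
        EuclideanSpace ℝ (Fin 3) →L[ℝ] EuclideanSpace ℝ (Fin 3)) : EuclideanSpace ℝ (Fin 3) →ₗ[ℝ] EuclideanSpace ℝ (Fin 3)) ↔
      M x = lam • x := by
  rw [LinearMap.mem_ker, ContinuousLinearMap.coe_coe]
  simp only [sub_apply, smul_apply, ContinuousLinearMap.id_apply]
  exact sub_eq_zero

/-- Membership in `ker (M² + βM + γ₀)` means `M(Mx) + βMx + γ₀x = 0`. [folklore] -/
theorem mem_ker_quadratic_iff (M : EuclideanSpace ℝ (Fin 3) →L[ℝ] EuclideanSpace ℝ (Fin 3)) (β γ₀ : ℝ)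
    (x : EuclideanSpace ℝ (Fin 3)) :
    x ∈ LinearMap.ker ((M.comp M + β • M + γ₀ • ContinuousLinearMap.id ℝ (EuclideanSpace ℝ (Fin 3)) :
        EuclideanSpace ℝ (Fin 3) →L[ℝ] EuclideanSpace ℝ (Fin 3)) : EuclideanSpace ℝ (Fin 3) →ₗ[ℝ] EuclideanSpace ℝ (Fin 3)) ↔
      M (M x) + β • M x + γ₀ • x = 0 := by
  rw [LinearMap.mem_ker, ContinuousLinearMap.coe_coe, quadOp_apply]

/-! ### Powers of `M` -/

/-- `M^{k+1} x = M^k (M x)`. [folklore] -/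
theorem pow_succ_apply (M : EuclideanSpace ℝ (Fin 3) →L[ℝ] EuclideanSpace ℝ (Fin 3)) (k : ℕ) (x : EuclideanSpace ℝ (Fin 3)) :
    (M ^ (k + 1)) x = (M ^ k) (M x) := by
  rw [pow_succ, ContinuousLinearMap.mul_def, ContinuousLinearMap.comp_apply]

/-- `M^{k+1} x = M (M^k x)`. [folklore] -/
theorem pow_succ_apply' (M : EuclideanSpace ℝ (Fin 3) →L[ℝ] EuclideanSpace ℝ (Fin 3)) (k : ℕ) (x : EuclideanSpace ℝ (Fin 3)) :
    (M ^ (k + 1)) x = M ((M ^ k) x) := by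
  rw [pow_succ', ContinuousLinearMap.mul_def, ContinuousLinearMap.comp_apply]

/-- On an eigenvector, `M^k v = r^k v`. [folklore] -/
theorem pow_apply_of_eigen (M : EuclideanSpace ℝ (Fin 3) →L[ℝ] EuclideanSpace ℝ (Fin 3)) {r : ℝ}
    {v : EuclideanSpace ℝ (Fin 3)} (hv : M v = r • v) (k : ℕ) : (M ^ k) v = r ^ k • v := by
  induction k with
  | zero => simp
  | succ k ih => rw [pow_succ_apply', ih, map_smul, hv, smul_smul, pow_succ]

end Summit.NavierStokesRegularity.NavierStokesRegularity.Theorems.PowerGaugeEulerLiouville.DSSNodes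

end
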